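import Summits.ResolutionOfSingularities.ResolutionOfSingularities.Theorems.PurelyInseparableDim4SwapTransportWindowStepFull
import HarnessLib
import HarnessLib.Audit.Tags

/-!
# Purely inseparable four-folds — THE VIRTUAL WINDOW, ITERATED: nine real steps (slot steps or rotations) of the C∞ chain are
# shadowed by nine PURE slot steps of the framed virtual partner, and res-dim4-p-3 g4's `ResCone.cInf_window_false` is played
# on the shadow (cell `res-dim4-pi`, K2(p) lane, slice B; K24b-R1 `virtual_window`)

[OURS · counted 0 · cell `res-dim4-pi` · K24b-R1 (res-dim4-typ-1 g3).]  Nothing here proves K2(p)/K2(5), `NoIsolatedTrap 5 5`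
or resolution of singularities in dimension ≥ 4 / characteristic `p` — NOT proved.  AI kernel work, weaker than expert review.

* §1 **`virtual_step_any`** — one real step of any kind (slot step in either slot chart, or rotation through either free
  letter dropping either slot), read through `step_cases_of_weights`, is shadowed by the pure virtual slot step in the chart
  `ℓ ∈ {λ, μ}` given by the RECURSION RULE `ℓ = if jr = π λ then λ else if jr = π μ then μ else if b (π λ) ≠ 0 then λ else μ`,
  with the new bijection `π⁺ = if jr ∈ {π λ, π μ} then π else π ∘ (ℓ π⁻¹(jr))`; the relation (precision `M − 5`), the real
  ledger along `π⁺` and the frame (jet `N − 4`) are returned in the fixed `(λ, μ)` orientation (`virtual_step_slot'`,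
  `virtual_step_rotate'` in both orientations).
* §2 `virtual_iterate` — the shadow follows the real chain for any number `T` of steps (budgets `Nc + 7 + 5T ≤ M`,
  `8 + 4T ≤ N`).
* §3 **`virtual_window_false_of_entry`** — given an ENTRY (a framed virtual state related to the real state `c k` along `π₀`
  at precision `M ≥ Nc + 57`, jet `N ≥ 48`, `Nc` a common isolation certificate level of `c k, …, c (k+9)`), the virtual data
  `(πs, Bs, ℓs)` generated by the recursion rule, and a virtual letter change at the start (`ℓs 0 = λ`, `ℓs 1 = μ`): `False`, by
  `ResCone.cInf_window_false` on `Bs` (its exact pair ledger at `Bs 0` is part of the entry frame).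
bears_on: LADDER-RESOLUTION:D157-DOOR2 (res-dim4-pi · K2(p) · slice B · K24b-R1).  Supports stmt-ResolutionOfSingularities-16155
(helper).
-/

set_option linter.dupNamespace false -- mandated namespace of this single-conjunct summit

noncomputable section

namespace Summit.ResolutionOfSingularities.ResolutionOfSingularities.Theorems.PIDim4

namespace SwapTransport

open MvPolynomial Finset
open Literature.AlgebraicGeometry.Resolution
open Literature.AlgebraicGeometry.Resolution.CentreBlowup
open Literature.AlgebraicGeometry.Resolution.Hauser2010
open Literature.AlgebraicGeometry.Resolution.HauserPerlega2019

variable {K : Type} [Field K] [CharP K 5] [DecidableEq K]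

/-! ## §1 One real step of any kind -/

/-- **ONE REAL STEP OF ANY KIND, SHADOWED** (see the module docstring, §1). [OURS] [cite: Hauser2010, §§F–G]
[cite: CossartJannsenSaito2020, Thm. 3.14] -/
theorem virtual_step_any {la mu u f : Fin 4} (hlm : la ≠ mu) (hlu : la ≠ u) (hlf : la ≠ f) (hmu : mu ≠ u) (hmf : mu ≠ f)
    (huf : u ≠ f) {π : Equiv.Perm (Fin 4)} {A B : State K} {M N Nc : ℕ}
    (hrel : ∃ (θ e : Fin 4 → MvPolynomial (Fin 4) K) (U E : MvPolynomial (Fin 4) K),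
      θ (π la) = X la * e la ∧ θ (π mu) = X mu * e mu ∧ constantCoeff (e la) ≠ 0 ∧ constantCoeff (e mu) ≠ 0 ∧
      constantCoeff (θ (π u)) = 0 ∧ constantCoeff (θ (π f)) = 0 ∧
      coeff (Finsupp.single u 1) (θ (π u)) * coeff (Finsupp.single f 1) (θ (π f)) -
        coeff (Finsupp.single f 1) (θ (π u)) * coeff (Finsupp.single u 1) (θ (π f)) ≠ 0 ∧
      constantCoeff U ≠ 0 ∧ E ∈ originIdeal K ^ M ∧ B.F = deletePthPowers 5 (U ^ 5 * aeval θ A.F) + E)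
    (hrA : A.r = Finsupp.single (π la) 1 + Finsupp.single (π mu) 1) (hoA : ordZero A.F = 6)
    (hfr : ordZero B.F = 6 ∧ B.r = Finsupp.single la 1 + Finsupp.single mu 1 ∧ (∀ d ∈ B.F.support, B.r ≤ d) ∧
      (∃ a : K, a ≠ 0 ∧ ResCone.resForm B = C a * X f ^ 4) ∧
      (∀ e ∈ B.F.support, e f ≤ 3 → 2 ≤ e la ∧ 2 ≤ e mu) ∧
      (∀ d ∈ B.F.support, d.degree < N → ¬ (d u = 2 ∧ d f = 0)) ∧
      coeff (B.r + (Finsupp.single la 1 + Finsupp.single mu 1 + Finsupp.single u 3)) B.F ≠ 0 ∧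
      IsIsolated 5 B.F ∧ Module.finrank K (ResCone.resVertex B) = 3)
    {jr : Fin 4} {b : Fin 4 → K} (hbj : b jr = 0) {A' : State K} (hstep : A' = CentreBlowup.step 5 Finset.univ jr b A)
    (hisoA' : IsIsolated 5 A'.F) (hcert : originIdeal K ^ Nc ≤ singLocusIdeal 5 A'.F ⊔ originIdeal K ^ (Nc + 1))
    (hoA' : ordZero A'.F = 6) (he3A' : Module.finrank K (ResCone.resVertex A') = 3) (hw1 : ∀ i, A'.r i ≤ 1)
    (hdegA' : A'.r.degree = 2) (hdivA' : ∀ d ∈ A'.F.support, A'.r ≤ d) (hM : Nc + 12 ≤ M) (hN : 12 ≤ N) :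
    ∃ (ℓ : Fin 4) (π' : Equiv.Perm (Fin 4)), (ℓ = la ∨ ℓ = mu) ∧
      (ℓ = if jr = π la then la else if jr = π mu then mu else if b (π la) ≠ 0 then la else mu) ∧
      (π' = if jr = π la ∨ jr = π mu then π else (Equiv.swap ℓ (π.symm jr)).trans π) ∧
      (∃ (θ' e' : Fin 4 → MvPolynomial (Fin 4) K) (U' E' : MvPolynomial (Fin 4) K),
        θ' (π' la) = X la * e' la ∧ θ' (π' mu) = X mu * e' mu ∧ constantCoeff (e' la) ≠ 0 ∧ constantCoeff (e' mu) ≠ 0 ∧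
        constantCoeff (θ' (π' u)) = 0 ∧ constantCoeff (θ' (π' f)) = 0 ∧
        coeff (Finsupp.single u 1) (θ' (π' u)) * coeff (Finsupp.single f 1) (θ' (π' f)) -
          coeff (Finsupp.single f 1) (θ' (π' u)) * coeff (Finsupp.single u 1) (θ' (π' f)) ≠ 0 ∧
        constantCoeff U' ≠ 0 ∧ E' ∈ originIdeal K ^ (M - 5) ∧
        (CentreBlowup.step 5 Finset.univ ℓ 0 B).F = deletePthPowers 5 (U' ^ 5 * aeval θ' A'.F) + E') ∧
      A'.r = Finsupp.single (π' la) 1 + Finsupp.single (π' mu) 1 ∧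
      (ordZero (CentreBlowup.step 5 Finset.univ ℓ 0 B).F = 6 ∧
        (CentreBlowup.step 5 Finset.univ ℓ 0 B).r = Finsupp.single la 1 + Finsupp.single mu 1 ∧
        (∀ d ∈ (CentreBlowup.step 5 Finset.univ ℓ 0 B).F.support, (CentreBlowup.step 5 Finset.univ ℓ 0 B).r ≤ d) ∧
        (∃ a : K, a ≠ 0 ∧ ResCone.resForm (CentreBlowup.step 5 Finset.univ ℓ 0 B) = C a * X f ^ 4) ∧
        (∀ e ∈ (CentreBlowup.step 5 Finset.univ ℓ 0 B).F.support, e f ≤ 3 → 2 ≤ e la ∧ 2 ≤ e mu) ∧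
        (∀ d ∈ (CentreBlowup.step 5 Finset.univ ℓ 0 B).F.support, d.degree < N - 4 → ¬ (d u = 2 ∧ d f = 0)) ∧
        coeff ((CentreBlowup.step 5 Finset.univ ℓ 0 B).r +
          (Finsupp.single la 1 + Finsupp.single mu 1 + Finsupp.single u 3)) (CentreBlowup.step 5 Finset.univ ℓ 0 B).F ≠ 0 ∧
        IsIsolated 5 (CentreBlowup.step 5 Finset.univ ℓ 0 B).F ∧
        Module.finrank K (ResCone.resVertex (CentreBlowup.step 5 Finset.univ ℓ 0 B)) = 3) := by
  obtain ⟨θ, e, U, E, hθa, hθa', hea, hea', hu0, hf0, hdet, hU, hE, hrelF⟩ := hrel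
  obtain ⟨hoB, hrB, hdivB, ⟨a, ha, hformB⟩, hledB, hrowB, hVB, -, -⟩ := hfr
  have hπlm : π la ≠ π mu := fun h => hlm (π.injective h)
  have hπlu : π la ≠ π u := fun h => hlu (π.injective h)
  have hπlf : π la ≠ π f := fun h => hlf (π.injective h)
  have hπmu : π mu ≠ π u := fun h => hmu (π.injective h)
  have hπmf : π mu ≠ π f := fun h => hmf (π.injective h)
  have hπuf : π u ≠ π f := fun h => huf (π.injective h)
  have hw1' : ∀ i, (CentreBlowup.step 5 Finset.univ jr b A).r i ≤ 1 := fun i => by rw [← hstep]; exact hw1 i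
  have hdeg' : (CentreBlowup.step 5 Finset.univ jr b A).r.degree = 2 := by rw [← hstep]; exact hdegA'
  -- the swapped-orientation copies of the inputs
  have hrAs : A.r = Finsupp.single (π mu) 1 + Finsupp.single (π la) 1 := by rw [hrA, add_comm]
  have hrBs : B.r = Finsupp.single mu 1 + Finsupp.single la 1 := by rw [hrB, add_comm]
  have hledBs : ∀ e ∈ B.F.support, e f ≤ 3 → 2 ≤ e mu ∧ 2 ≤ e la := fun e he hf => (hledB e he hf).symm
  have hVBs : coeff (B.r + (Finsupp.single mu 1 + Finsupp.single la 1 + Finsupp.single u 3)) B.F ≠ 0 := by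
    rw [add_comm (Finsupp.single mu 1) (Finsupp.single la 1)]; exact hVB
  have hdets : coeff (Finsupp.single u 1) (θ (π u)) * coeff (Finsupp.single f 1) (θ (π f)) -
      coeff (Finsupp.single f 1) (θ (π u)) * coeff (Finsupp.single u 1) (θ (π f)) ≠ 0 := hdet
  rcases step_cases_of_weights hπlm hπlu hπlf hπmu hπmf hπuf hrA hoA (jr := jr) (b := b) hw1' hdeg' with
    ⟨hjr, hbmu, -⟩ | ⟨hjr, hbla, -⟩ | ⟨hjr, hrot⟩
  · -- slot step in the chart of `π λ`
    subst hjr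
    obtain ⟨-, hrA', θ', e', U', E', h1, h2, h3, h4, h5, h6, h7, h8, h9, h10, hfr'⟩ :=
      virtual_step_slot' hlm hlu hlf hmu hmf huf hθa hθa' hea hea' hu0 hf0 hdet hU hE hrelF hoA hrA hbj hstep hisoA' hcert
        hoA' he3A' hw1 hdegA' hdivA' hoB hrB hdivB ha hformB hledB hN hrowB hVB hM
    refine ⟨la, π, Or.inl rfl, by rw [if_pos rfl], by rw [if_pos (Or.inl rfl)], ⟨θ', e', U', E', h1, h2, h3, h4, h5, h6, h7, h8,
      h9, h10⟩, hrA', hfr'⟩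
  · -- slot step in the chart of `π μ`
    subst hjr
    obtain ⟨-, hrA', θ', e', U', E', h1, h2, h3, h4, h5, h6, h7, h8, h9, h10, ho', hr', hdiv', hform', hled', hrow', hV',
      hiso', he3'⟩ :=
      virtual_step_slot' hlm.symm hmu hmf hlu hlf huf hθa' hθa hea' hea hu0 hf0 hdet hU hE hrelF hoA hrAs hbj hstep hisoA'
        hcert hoA' he3A' hw1 hdegA' hdivA' hoB hrBs hdivB ha hformB hledBs hN hrowB hVBs hM
    refine ⟨mu, π, Or.inr rfl, by rw [if_neg hπlm.symm, if_pos rfl], by rw [if_pos (Or.inr rfl)], ⟨θ', e', U', E', h2, h1,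
      h4, h3, h5, h6, h7, h8, h9, h10⟩, by rw [hrA', add_comm], ho', by rw [hr', add_comm], hdiv', hform',
      fun e he hf => (hled' e he hf).symm, hrow', ?_, hiso', he3'⟩
    rw [add_comm (Finsupp.single la 1) (Finsupp.single mu 1)]; exact hV'
  · -- rotation through the free letter `jr = π g`
    have hjl : jr ≠ π la := by rcases hjr with rfl | rfl <;> [exact hπlu.symm; exact hπlf.symm]
    have hjm : jr ≠ π mu := by rcases hjr with rfl | rfl <;> [exact hπmu.symm; exact hπmf.symm]
    -- the free letter `g` with `jr = π g`, and its partner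
    obtain ⟨g, gt, hg, hjg⟩ : ∃ g gt : Fin 4, ((g = u ∧ gt = f) ∨ (g = f ∧ gt = u)) ∧ jr = π g := by
      rcases hjr with h | h
      · exact ⟨u, f, Or.inl ⟨rfl, rfl⟩, h⟩
      · exact ⟨f, u, Or.inr ⟨rfl, rfl⟩, h⟩
    subst hjg
    have hsymm : π.symm (π g) = g := π.symm_apply_apply g
    rcases hrot with ⟨hbla, hbmu, hr'⟩ | ⟨hbmu, hbla, hr'⟩
    · -- the slot `π λ` is translated away: virtual chart `λ`
      have hrA'g : A'.r = Finsupp.single (π g) 1 + Finsupp.single (π mu) 1 := by rw [hstep, hr']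
      obtain ⟨π', θ', e', U', E', hπ', -, -, -, -, h1, h2, h3, h4, h5, h6, h7, h8, h9, h10, hfr'⟩ :=
        virtual_step_rotate' hlm hlu hlf hmu hmf huf hg hθa hθa' hea hea' hu0 hf0 hdet hU hE hrelF hoA hbj hbla hbmu hstep
          hisoA' hcert hoA' he3A' hrA'g hdivA' hoB hrB hdivB ha hformB hledB hN hrowB hVB hM
      have hπ'l : π' la = π g := by rw [hπ', Equiv.trans_apply, Equiv.swap_apply_left]
      have hπ'm : π' mu = π mu := by
        have hmg : mu ≠ g := by rcases hg with ⟨rfl, -⟩ | ⟨rfl, -⟩ <;> [exact hmu; exact hmf]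
        rw [hπ', Equiv.trans_apply, Equiv.swap_apply_of_ne_of_ne hlm.symm hmg]
      refine ⟨la, π', Or.inl rfl, by rw [if_neg hjl, if_neg hjm, if_pos hbla], by rw [if_neg (not_or.mpr ⟨hjl, hjm⟩), hsymm, hπ'],
        ⟨θ', e', U', E', h1, h2, h3, h4, h5, h6, h7, h8, h9, h10⟩, by rw [hrA'g, hπ'l, hπ'm], hfr'⟩
    · -- the slot `π μ` is translated away: virtual chart `μ`
      have hrA'g : A'.r = Finsupp.single (π g) 1 + Finsupp.single (π la) 1 := by rw [hstep, hr']
      obtain ⟨π', θ', e', U', E', hπ', -, -, -, -, h1, h2, h3, h4, h5, h6, h7, h8, h9, h10, ho', hr'', hdiv', hform', hled',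
        hrow', hV', hiso', he3'⟩ :=
        virtual_step_rotate' hlm.symm hmu hmf hlu hlf huf hg hθa' hθa hea' hea hu0 hf0 hdet hU hE hrelF hoA hbj hbmu hbla hstep
          hisoA' hcert hoA' he3A' hrA'g hdivA' hoB hrBs hdivB ha hformB hledBs hN hrowB hVBs hM
      have hπ'm : π' mu = π g := by rw [hπ', Equiv.trans_apply, Equiv.swap_apply_left]
      have hπ'l : π' la = π la := by
        have hlg : la ≠ g := by rcases hg with ⟨rfl, -⟩ | ⟨rfl, -⟩ <;> [exact hlu; exact hlf]
        rw [hπ', Equiv.trans_apply, Equiv.swap_apply_of_ne_of_ne hlm hlg]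
      have hbla' : ¬ b (π la) ≠ 0 := fun h => h hbla
      refine ⟨mu, π', Or.inr rfl, by rw [if_neg hjl, if_neg hjm, if_neg hbla'],
        by rw [if_neg (not_or.mpr ⟨hjl, hjm⟩), hsymm, hπ'], ⟨θ', e', U', E', h2, h1, h4, h3, h5, h6, h7, h8, h9, h10⟩,
        by rw [hrA'g, hπ'l, hπ'm, add_comm], ho', by rw [hr'', add_comm], hdiv', hform', fun e he hf => (hled' e he hf).symm,
        hrow', ?_, hiso', he3'⟩
      rw [add_comm (Finsupp.single la 1) (Finsupp.single mu 1)]; exact hV'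

/-! ## §2 Iteration through any number of real steps -/

/-- **THE SHADOW FOLLOWS THE REAL CHAIN** for `T` steps of any kind: the relation (precision `M − 5t`), the real ledger
along `πs t` and the frame (jet `N − 4t`) at every `t ≤ T`, from an entry at `t = 0` and the virtual data generated by
the recursion rule; budgets `Nc + 7 + 5T ≤ M`, `8 + 4T ≤ N`. [OURS] -/
theorem virtual_iterate {la mu u f : Fin 4} (hlm : la ≠ mu) (hlu : la ≠ u) (hlf : la ≠ f) (hmu : mu ≠ u)
    (hmf : mu ≠ f) (huf : u ≠ f) {c : ℕ → State K} {j : ℕ → Fin 4} {b : ℕ → Fin 4 → K}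
    (hw : FreeTail.IsWitnessedChain 5 c j b) {k Nc T : ℕ} (hisoR : ∀ t, t ≤ T → IsIsolated 5 (c (k + t)).F)
    (hcert : ∀ t, t ≤ T → originIdeal K ^ Nc ≤ singLocusIdeal 5 (c (k + t)).F ⊔ originIdeal K ^ (Nc + 1))
    (hoR : ∀ t, t ≤ T → ordZero (c (k + t)).F = 6)
    (he3R : ∀ t, t ≤ T → Module.finrank K (ResCone.resVertex (c (k + t))) = 3)
    (hwtR : ∀ t, t ≤ T → (∀ i, (c (k + t)).r i ≤ 1) ∧ (c (k + t)).r.degree = 2)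
    (hdivR : ∀ t, t ≤ T → ∀ d ∈ (c (k + t)).F.support, (c (k + t)).r ≤ d)
    {πs : ℕ → Equiv.Perm (Fin 4)} {Bs : ℕ → State K} {ℓs : ℕ → Fin 4}
    (hBs : ∀ t, Bs (t + 1) = CentreBlowup.step 5 Finset.univ (ℓs t) 0 (Bs t))
    (hℓs : ∀ t, ℓs t = if j (k + t) = πs t la then la else if j (k + t) = πs t mu then mu
      else if b (k + t) (πs t la) ≠ 0 then la else mu)
    (hπs : ∀ t, πs (t + 1) = if j (k + t) = πs t la ∨ j (k + t) = πs t mu then πs t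
      else (Equiv.swap (ℓs t) ((πs t).symm (j (k + t)))).trans (πs t))
    {M N : ℕ} (hM : Nc + 7 + 5 * T ≤ M) (hN : 8 + 4 * T ≤ N)
    (hrel0 : ∃ (θ e : Fin 4 → MvPolynomial (Fin 4) K) (U E : MvPolynomial (Fin 4) K),
      θ (πs 0 la) = X la * e la ∧ θ (πs 0 mu) = X mu * e mu ∧ constantCoeff (e la) ≠ 0 ∧ constantCoeff (e mu) ≠ 0 ∧
      constantCoeff (θ (πs 0 u)) = 0 ∧ constantCoeff (θ (πs 0 f)) = 0 ∧
      coeff (Finsupp.single u 1) (θ (πs 0 u)) * coeff (Finsupp.single f 1) (θ (πs 0 f)) -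
        coeff (Finsupp.single f 1) (θ (πs 0 u)) * coeff (Finsupp.single u 1) (θ (πs 0 f)) ≠ 0 ∧
      constantCoeff U ≠ 0 ∧ E ∈ originIdeal K ^ M ∧ (Bs 0).F = deletePthPowers 5 (U ^ 5 * aeval θ (c k).F) + E)
    (hrA0 : (c k).r = Finsupp.single (πs 0 la) 1 + Finsupp.single (πs 0 mu) 1)
    (hfr0 : ordZero (Bs 0).F = 6 ∧ (Bs 0).r = Finsupp.single la 1 + Finsupp.single mu 1 ∧
      (∀ d ∈ (Bs 0).F.support, (Bs 0).r ≤ d) ∧ (∃ a : K, a ≠ 0 ∧ ResCone.resForm (Bs 0) = C a * X f ^ 4) ∧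
      (∀ e ∈ (Bs 0).F.support, e f ≤ 3 → 2 ≤ e la ∧ 2 ≤ e mu) ∧
      (∀ d ∈ (Bs 0).F.support, d.degree < N → ¬ (d u = 2 ∧ d f = 0)) ∧
      coeff ((Bs 0).r + (Finsupp.single la 1 + Finsupp.single mu 1 + Finsupp.single u 3)) (Bs 0).F ≠ 0 ∧
      IsIsolated 5 (Bs 0).F ∧ Module.finrank K (ResCone.resVertex (Bs 0)) = 3) :
    ∀ t, t ≤ T →
      (∃ (θ e : Fin 4 → MvPolynomial (Fin 4) K) (U E : MvPolynomial (Fin 4) K),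
        θ (πs t la) = X la * e la ∧ θ (πs t mu) = X mu * e mu ∧ constantCoeff (e la) ≠ 0 ∧ constantCoeff (e mu) ≠ 0 ∧
        constantCoeff (θ (πs t u)) = 0 ∧ constantCoeff (θ (πs t f)) = 0 ∧
        coeff (Finsupp.single u 1) (θ (πs t u)) * coeff (Finsupp.single f 1) (θ (πs t f)) -
          coeff (Finsupp.single f 1) (θ (πs t u)) * coeff (Finsupp.single u 1) (θ (πs t f)) ≠ 0 ∧
        constantCoeff U ≠ 0 ∧ E ∈ originIdeal K ^ (M - 5 * t) ∧
        (Bs t).F = deletePthPowers 5 (U ^ 5 * aeval θ (c (k + t)).F) + E) ∧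
      (c (k + t)).r = Finsupp.single (πs t la) 1 + Finsupp.single (πs t mu) 1 ∧
      (ordZero (Bs t).F = 6 ∧ (Bs t).r = Finsupp.single la 1 + Finsupp.single mu 1 ∧
        (∀ d ∈ (Bs t).F.support, (Bs t).r ≤ d) ∧ (∃ a : K, a ≠ 0 ∧ ResCone.resForm (Bs t) = C a * X f ^ 4) ∧
        (∀ e ∈ (Bs t).F.support, e f ≤ 3 → 2 ≤ e la ∧ 2 ≤ e mu) ∧
        (∀ d ∈ (Bs t).F.support, d.degree < N - 4 * t → ¬ (d u = 2 ∧ d f = 0)) ∧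
        coeff ((Bs t).r + (Finsupp.single la 1 + Finsupp.single mu 1 + Finsupp.single u 3)) (Bs t).F ≠ 0 ∧
        IsIsolated 5 (Bs t).F ∧ Module.finrank K (ResCone.resVertex (Bs t)) = 3) := by
  intro t
  induction t with
  | zero =>
    intro _
    simp only [Nat.mul_zero, Nat.sub_zero, Nat.add_zero]
    exact ⟨hrel0, hrA0, hfr0⟩
  | succ t ih =>
    intro ht
    obtain ⟨hrel, hrA, hfr⟩ := ih (by omega)
    obtain ⟨-, hbj, -, -, hcs⟩ := hw (k + t)
    have hcs' : c (k + (t + 1)) = CentreBlowup.step 5 Finset.univ (j (k + t)) (b (k + t)) (c (k + t)) := hcs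
    obtain ⟨ℓ, π', -, hℓeq, hπ'eq, hrel', hrA', hfr'⟩ := virtual_step_any hlm hlu hlf hmu hmf huf hrel hrA
      (hoR t (by omega)) hfr hbj hcs' (hisoR (t + 1) ht) (hcert (t + 1) ht) (hoR (t + 1) ht) (he3R (t + 1) ht)
      (hwtR (t + 1) ht).1 (hwtR (t + 1) ht).2 (hdivR (t + 1) ht) (by omega) (by omega)
    have hℓt : ℓs t = ℓ := by rw [hℓs t, hℓeq]
    have hπt : πs (t + 1) = π' := by rw [hπs t, hπ'eq, hℓt]
    have hBt : Bs (t + 1) = CentreBlowup.step 5 Finset.univ ℓ 0 (Bs t) := by rw [hBs t, hℓt]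
    have hM5 : M - 5 * t - 5 = M - 5 * (t + 1) := by omega
    have hN4 : N - 4 * t - 4 = N - 4 * (t + 1) := by omega
    rw [hπt, hBt, ← hM5, ← hN4]
    exact ⟨hrel', hrA', hfr'⟩

/-! ## §3 The window from an entry -/


/-- **THE VIRTUAL WINDOW IS PLAYED** (module docstring, §2): from an entry at real time `k`, nine shadowed steps
(`virtual_step_any`) and res-dim4-p-3 g4's `ResCone.cInf_window_false` on the shadow. [OURS] [cite: Hauser2010, §§F–G]
[cite: CossartJannsenSaito2020, Thm. 3.14] -/
theorem virtual_window_false_of_entry {la mu u f : Fin 4} (hlm : la ≠ mu) (hlu : la ≠ u) (hlf : la ≠ f) (hmu : mu ≠ u)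
    (hmf : mu ≠ f) (huf : u ≠ f) {c : ℕ → State K} {j : ℕ → Fin 4} {b : ℕ → Fin 4 → K}
    (hw : FreeTail.IsWitnessedChain 5 c j b) {k Nc : ℕ} (hisoR : ∀ t, t ≤ 9 → IsIsolated 5 (c (k + t)).F)
    (hcert : ∀ t, t ≤ 9 → originIdeal K ^ Nc ≤ singLocusIdeal 5 (c (k + t)).F ⊔ originIdeal K ^ (Nc + 1))
    (hoR : ∀ t, t ≤ 9 → ordZero (c (k + t)).F = 6)
    (he3R : ∀ t, t ≤ 9 → Module.finrank K (ResCone.resVertex (c (k + t))) = 3)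
    (hwtR : ∀ t, t ≤ 9 → (∀ i, (c (k + t)).r i ≤ 1) ∧ (c (k + t)).r.degree = 2)
    (hdivR : ∀ t, t ≤ 9 → ∀ d ∈ (c (k + t)).F.support, (c (k + t)).r ≤ d)
    {πs : ℕ → Equiv.Perm (Fin 4)} {Bs : ℕ → State K} {ℓs : ℕ → Fin 4}
    (hBs : ∀ t, Bs (t + 1) = CentreBlowup.step 5 Finset.univ (ℓs t) 0 (Bs t))
    (hℓs : ∀ t, ℓs t = if j (k + t) = πs t la then la else if j (k + t) = πs t mu then mu
      else if b (k + t) (πs t la) ≠ 0 then la else mu)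
    (hπs : ∀ t, πs (t + 1) = if j (k + t) = πs t la ∨ j (k + t) = πs t mu then πs t
      else (Equiv.swap (ℓs t) ((πs t).symm (j (k + t)))).trans (πs t))
    {M N : ℕ} (hM : Nc + 57 ≤ M) (hN : 48 ≤ N)
    (hrel0 : ∃ (θ e : Fin 4 → MvPolynomial (Fin 4) K) (U E : MvPolynomial (Fin 4) K),
      θ (πs 0 la) = X la * e la ∧ θ (πs 0 mu) = X mu * e mu ∧ constantCoeff (e la) ≠ 0 ∧ constantCoeff (e mu) ≠ 0 ∧
      constantCoeff (θ (πs 0 u)) = 0 ∧ constantCoeff (θ (πs 0 f)) = 0 ∧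
      coeff (Finsupp.single u 1) (θ (πs 0 u)) * coeff (Finsupp.single f 1) (θ (πs 0 f)) -
        coeff (Finsupp.single f 1) (θ (πs 0 u)) * coeff (Finsupp.single u 1) (θ (πs 0 f)) ≠ 0 ∧
      constantCoeff U ≠ 0 ∧ E ∈ originIdeal K ^ M ∧ (Bs 0).F = deletePthPowers 5 (U ^ 5 * aeval θ (c k).F) + E)
    (hrA0 : (c k).r = Finsupp.single (πs 0 la) 1 + Finsupp.single (πs 0 mu) 1)
    (hfr0 : ordZero (Bs 0).F = 6 ∧ (Bs 0).r = Finsupp.single la 1 + Finsupp.single mu 1 ∧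
      (∀ d ∈ (Bs 0).F.support, (Bs 0).r ≤ d) ∧ (∃ a : K, a ≠ 0 ∧ ResCone.resForm (Bs 0) = C a * X f ^ 4) ∧
      (∀ e ∈ (Bs 0).F.support, e f ≤ 3 → 2 ≤ e la ∧ 2 ≤ e mu) ∧
      (∀ d ∈ (Bs 0).F.support, d.degree < N → ¬ (d u = 2 ∧ d f = 0)) ∧
      coeff ((Bs 0).r + (Finsupp.single la 1 + Finsupp.single mu 1 + Finsupp.single u 3)) (Bs 0).F ≠ 0 ∧
      IsIsolated 5 (Bs 0).F ∧ Module.finrank K (ResCone.resVertex (Bs 0)) = 3)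
    (hx0 : ℓs 0 = la) (hx1 : ℓs 1 = mu) : False := by
  have hP := virtual_iterate hlm hlu hlf hmu hmf huf hw hisoR hcert hoR he3R hwtR hdivR hBs hℓs hπs (T := 9) (by omega)
    (by omega) hrel0 hrA0 hfr0
  have hslot : ∀ t, t < 9 → ℓs t = la ∨ ℓs t = mu := fun t _ => by
    rw [hℓs t]
    split_ifs
    exacts [Or.inl rfl, Or.inr rfl, Or.inl rfl, Or.inr rfl]
  exact ResCone.cInf_window_false hlm hlu hlf hmu hmf huf (c := Bs) (j := ℓs) (fun t ht => (hP t ht).2.2.2.2.2.2.2.2.2.1)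
    (fun t ht => by exact_mod_cast (hP t ht).2.2.1) (fun t ht => (hP t ht).2.2.2.2.2.2.2.2.2.2)
    (fun t ht => (hP t ht).2.2.2.2.1) (fun t _ => hBs t) hslot (fun t ht => (hP t ht).2.2.2.1)
    (fun t ht => (hP t ht).2.2.2.2.2.1) hfr0.2.2.2.2.1 hx0 hx1

end SwapTransport

end Summit.ResolutionOfSingularities.ResolutionOfSingularities.Theorems.PIDim4

end
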